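/-
Copyright (c) 2026 the pub-hodgecm-mathlib formalisation cell (harness21).  Prover seat hodgecm-mathlib-K2Liu-p03 (g8), Track B «K2-LIT»,
#184♮ = hLiu418 = `stmt-HodgeConjecture-24832`; socket #41, KIND 1 — (K1a-T) ED. 2 «(A) THE TAIL WITNESSES»: ★ p863805 `htail_hsplit_of_record` RE-PROVED WITNESS-TRANSPARENT
(K1-a♮ line lead K2E5-p16 (g8) WORD #12 (2) «(A) GO» 2026-09-05T01:20:29Z; K2Liu-p01 (g11) STANDING FINDING 01:27:54Z): the same `∃ σc gc T D Pm mτ A W` package (conjuncts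
(a)–(e) BYTE-IDENTICAL) PLUS the DEFINING LETTERS of every witness — the Levi chart `Λ` and row section `γ` BY VALUE, the rank-one presentation, the exceptional set
`T S h = kindWFinset (T₀ ∪ Tp S) (σc(S)E₁₁) (gc S·h)` with `Tp S = T_rec ∪ Pol(τ(σc S))` for ONE record set `T_rec`, `Pm = T ∖ T₀`, `D = {|τ|_v ≠ 1} ∖ T`, `mτ = ord_v τ`.
THEOREMS ONLY (no `def`, no `instance`, no notation, no named-fact hypothesis, no `sorry`).
-/
import Summits.HodgeConjecture.HodgeConjecture.Theorems.K2LiuKindOneSingularTailOfCornerLetters     -- ★ p864019 FILE W (this seat): `htail_hsplit_of_cornerLetters` (∃-free tail identity)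
import Summits.HodgeConjecture.HodgeConjecture.Theorems.K2LiuKindOneSingularCornerPresentation     -- ★ p864116 (C-b) (this seat): `exists_cornerPresentation_of_record`
import Summits.HodgeConjecture.HodgeConjecture.Theorems.K2LiuRankOneSingularLocalValueCMRecordSplit -- ★ p864079 (C-a) (this seat): `exists_recordFinset_forall_integral_conjChar_lambdaLoc_weylDelta_eq`
import Summits.HodgeConjecture.HodgeConjecture.Theorems.K2LiuKindOneSingularTailOfRecord            -- ★ p863805 ED. 1 (this seat): `differentiable_twistedPoly`
import HarnessLib

/-!
# Crux `HLiu418`, socket #41, KIND 1 a♮ — (K1a-T) ED. 2 `K2LiuKindOneSingularTailWitnesses`: THE SINGULAR TAIL OF RECORD WITH ITS WITNESSES' DEFINING LETTERS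

Cell `hodgecm-mathlib`, crux item hLiu418 = `stmt-HodgeConjecture-24832` (helper lane `--supports … --as helper`, count-neutral), route of record `HCCMUnconditional`;
squad K2 ∕ K2Liu, road `K2_Liu`, socket #41 `sig_K2LiuSiegelEisensteinContinuation`, KIND 1, block K1-a♮.  CONSUMERS: the K1-a♮ assembly of record ★ p864122
`K2LiuKindOneSingularTermOfRecord.exists_kindOne_singularTerm_of_record` (K2Liu-p01 (g11)) and the payers of its witness-dependent letters — (L4-den)∕(L5-den) counts in the
`D`-currency (this seat's (C-d), LH7-p05 (g3)'s (C-c), K2E4-p10 (g10)'s `hdec_of_factorBounds_den`), block D's `hint hPval hD` (F0P2-p11 (g3)).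

WHY.  ★ p863805 ED. 1 hides its witnesses behind `∃ σc gc T D Pm mτ A W`, so no letter ABOUT them (a count of `Pm S h`, the degree of the shell polynomials, the
membership of `D S h`) can be paid from outside; and the `S`-UNIFORM versions of those letters are false (desk WORD #12: at fixed archimedean size the denominators of
`τ(σc S)` are unbounded).  THIS EDITION keeps ED. 1's statement block token for token and APPENDS, inside the same `∃`, the defining letters of every witness:
* **`htail_hsplit_witnesses_of_record`** — hypotheses = ★ ED. 1's + the Levi chart `Λ` (★ α3-2 block law `hΛ`) and a row section `γ` (`hγ`) BY VALUE (★ (C-b)'s binders).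
  Conclusion = `∃ σc gc T D Pm mτ A W`, ED. 1's (a) transport, (b) witness equations, (c) place-set letters, (d) `hq hP`, (e) the tail identity — VERBATIM — and
  `∃ u w (hw : ∀ S, w S ≠ 0) T_rec Tp` with: (f) `gc S = Λ(map γ[w S])`; (g) for rank-one `S`: `↑S = vecMulVec (u S) (w S)`, `∀ k, T_L k k·S k k = c(γ[w S]₁ₖ)·T_L 1 1·σc S·γ[w S]₁ₖ`,
  `t₁·Tr(σc(S)δ) ≠ 0` (★ (C-b)); (h1) `T S h = kindWFinset (T₀ ∪ Tp S) (σc(S)E₁₁) (gc S·h)`; (h2) `v ∈ Tp S ↔ v ∈ T_rec ∨ 1 < |ι_v τ(σc S)|_v` — `T_rec` is ★ (C-a)'s record set,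
  INDEPENDENT of `S`; (h3) `Pm S h = T S h ∖ T₀`; (h4) for rank-one `S`: `v ∈ D S h ↔ |ι_v τ(σc S)|_v ≠ 1 ∧ v ∉ T S h`; (h5) `mτ S v = (−log|ι_v τ(σc S)|_v).toNat`;
  (j) `v ∉ T S h → v ∉ T₀ ∧ v ∉ T_rec ∧ |ι_v τ(σc S)|_v ≤ 1`.
  Proof: ★ (C-b) ∘ ★ (C-a) ∘ ★ FILE W `htail_hsplit_of_cornerLetters` at `S' := σc(S)E₁₁`, `h' := gc S·h`, `T₁ := T_rec ∪ Pol(τ)` (the value letter off `T₁` is ★ (C-a):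
  off the pole set `τ` is `v`-integral).
* `setOf_one_lt_valued_finite` — the pole set `{v : 1 < |ι_v x|_v}` of any `x ∈ L⁺` is finite.
HONEST LABEL.  Count-neutral helper (★ ED. 1 re-addressed for transparency over ★ (C-a)(C-b)(W); no new analytic input); it closes no socket: `HC_CM` is proved only
modulo the 7 printed citations (2 remaining named inputs: hLiu418 = `stmt-HodgeConjecture-24832`, h413 = `stmt-HodgeConjecture-24833`) until rung 0 closes.

## References
* [KudlaRallis1994] S. Kudla, S. Rallis, *A regularized Siegel–Weil formula: the first term identity*, Ann. of Math. 140 (1994): §2 (2.10)–(2.12).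
* [Tan1999] V. Tan, *Poles of Siegel Eisenstein series on U(n,n)*, Canad. J. Math. 51 (1999): §3, §4 Prop. 4.8.
* [Shimura1997] G. Shimura, *Euler Products and Eisenstein Series*, CBMS 93 (1997): §18.3–18.4.
* [MoeglinWaldspurger1995] C. Mœglin, J.-L. Waldspurger, *Spectral Decomposition and Eisenstein Series* (1995): II.1.7.
* [CasselsFrohlichANT1967] Cassels–Fröhlich (eds.), *Algebraic Number Theory* (1967): Ch. II §§4–5, Ch. XV (Tate) Thm. 3.3.1.
-/

set_option autoImplicit false
-- the mandated namespace repeats the single-problem summit's segment (`HodgeConjecture.HodgeConjecture`)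
set_option linter.dupNamespace false

noncomputable section

open scoped Matrix RestrictedProduct ENNReal NNReal Topology ComplexConjugate
open NumberField IsDedekindDomain MeasureTheory Measure Filter Set

namespace Summit.HodgeConjecture.HodgeConjecture.Cruxes.HLiu418.K2LiuKindOneSingularTailWitnesses

open Literature.NumberTheory.Automorphic Literature.NumberTheory.Automorphic.UnitaryGroup Literature.NumberTheory.GaloisRepresentations Literature.NumberTheory.LFunctions
open Literature.NumberTheory.GelbartRogawski1991 Literature.NumberTheory.GelbartRogawski1991.GRConstruction
open Literature.NumberTheory.GelbartRogawski1991.AdaptedBlocks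
open Literature.NumberTheory.GelbartRogawski1991.UnitaryDualPair
open Literature.NumberTheory.K2Lit.SiegelDoubled
open Literature.NumberTheory.K2Lit.PlaceSplitting
open Literature.MeasureTheory.RestrictedProduct
open Literature.Topology.Algebra.RestrictedProduct (inH)
open Literature.NumberTheory.Automorphic.IdeleClassGroup (IsConjugateSymplectic toHeckeCharacter isUnitary_toHeckeCharacter)
open Summit.HodgeConjecture.HodgeConjecture.Cruxes.HLiu418.K2LiuSiegelUnipotentLocalDefs
open Summit.HodgeConjecture.HodgeConjecture.Cruxes.HLiu418.K2LiuSiegelUnipotentSplitDefs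
open Summit.HodgeConjecture.HodgeConjecture.Cruxes.HLiu418.K2LiuSiegelUnipotentSplitAtDefs
open Summit.HodgeConjecture.HodgeConjecture.Cruxes.HLiu418.K2LiuSiegelUnipotentFourierDefs
open Summit.HodgeConjecture.HodgeConjecture.Cruxes.HLiu418.K2LiuSiegelEisensteinKindWLetters
open Summit.HodgeConjecture.HodgeConjecture.Cruxes.HLiu418.K2LiuSiegelMiddleCellLeviCriterion (row_ne_zero)
open Summit.HodgeConjecture.HodgeConjecture.Cruxes.HLiu418.K2LiuRankOneSingularLocalValueCMRecordSplit
  (exists_recordFinset_forall_integral_conjChar_lambdaLoc_weylDelta_eq)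
open Summit.HodgeConjecture.HodgeConjecture.Cruxes.HLiu418.K2LiuKindOneSingularCornerPresentation (exists_cornerPresentation_of_record)
open Summit.HodgeConjecture.HodgeConjecture.Cruxes.HLiu418.K2LiuKindOneSingularTailOfCornerLetters (htail_hsplit_of_cornerLetters)
open Summit.HodgeConjecture.HodgeConjecture.Cruxes.HLiu418.K2LiuKindOneSingularTailOfRecord (differentiable_twistedPoly)

variable (L : Type) [Field L] [NumberField L] [IsCMField L]

omit [IsCMField L] in
/-- the POLE SET `{v : 1 < |ι_v x|_v}` of an element `x ∈ L⁺` is finite (empty for `x = 0`; inside the finite set `{|ι_v x|_v ≠ 1}` otherwise).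
[cite: CasselsFrohlichANT1967, Ch. II §4] -/
theorem setOf_one_lt_valued_finite (x : Fp L) :
    {v : HeightOneSpectrum (𝓞 (Fp L)) | 1 < Valued.v (algebraMap (Fp L) (v.adicCompletion (Fp L)) x)}.Finite := by
  by_cases hx : x = 0
  · subst hx
    simp only [map_zero, not_lt_zero, Set.setOf_false, Set.finite_empty]
  · exact (Filter.eventually_cofinite.1 (UnitaryGroup.eventually_valued_algebraMap_eq_one (Fp L) hx)).subset fun v hv => ne_of_gt hv

section Head

variable {N M : ℕ} (e : Fin N × Fin M ≃ Fin 2)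
  (dV : Fin N → L) (hdV : ∀ i, IsCMField.complexConj L (dV i) = dV i)
  (dW : Fin M → L) (hdW : ∀ i, IsCMField.complexConj L (dW i) = dW i)
  [DecidableEq (HeightOneSpectrum (𝓞 (Fp L)))]
  [MeasurableSpace ↥(unipDelta L e dV hdV dW hdW)] [BorelSpace ↥(unipDelta L e dV hdV dW hdW)]
  [MeasurableSpace ↥(unipDeltaArch L e dV hdV dW hdW)] [BorelSpace ↥(unipDeltaArch L e dV hdV dW hdW)]
  [∀ v : HeightOneSpectrum (𝓞 (Fp L)), MeasurableSpace ↥(unipDeltaLoc L e dV hdV dW hdW v)] [∀ v : HeightOneSpectrum (𝓞 (Fp L)), BorelSpace ↥(unipDeltaLoc L e dV hdV dW hdW v)]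

set_option maxHeartbeats 800000 in -- MEASURED class of ★ p863805 ED. 1 ∕ ★ FILE W (the same statement block: the Whittaker–Euler `hmap` telescope and the two summand integrands); structural `rw`∕`exact` only
/-- **(K1a-T) ED. 2 — THE SINGULAR TAIL OF RECORD WITH ITS WITNESSES' DEFINING LETTERS.**
DATA: ★ ED. 1's — the doubled CM datum of rank `2` (`hdV0 hdW0`), `lam` conjugate-symplectic, `f_s ∈ I_Δ(s, toHeckeCharacter L lam⁻¹)` continuous (`hsec hcont`), a Haar
measure `νN` on `N_Δ(𝔸)`, a real scalar `c₀`; the Whittaker–Euler data BY VALUE (`T₀ νv hνK νinf hσ hmap hχ hfac`), the place-indexed Σ⊗ slices (`Finf Fv hslice`), per-factor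
integrability (`hintArch hintLoc`) — PLUS, by value, a Levi chart `Λ : GL₂(𝔸_L) →* H(𝔸)` with ★ α3-2's block law (`hΛ`) and a section `γ` of the second row (`hγ`).
CONCLUSION: `∃ σc gc T D Pm mτ A W` with ★ ED. 1's conjuncts VERBATIM — (a) corner transport; (b) the two WITNESS EQUATIONS for `A`, `W`; (c) `T₀ ⊆ T S h`, `Pm S h` misses
`T₀`, `↑T₀ ∪ ↑(Pm S h) = ↑(T S h)`, `D S h` misses `T S h`; (d) `hq`, `hP`; (e) the tail identity on `{1 < re s}` — AND `∃ u w (hw : ∀ S, w S ≠ 0) T_rec Tp` with the DEFINING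
LETTERS: (f) `gc S = Λ(map γ[w S])`; (g) for rank-one `S`: `↑S = vecMulVec (u S) (w S)`, `∀ k, T_L k k·↑S k k = c(γ[w S]₁ₖ)·T_L 1 1·σc S·γ[w S]₁ₖ`, `t₁·Tr_{L∕L⁺}(σc(S)δ) ≠ 0`;
(h1) `T S h = kindWFinset (T₀ ∪ Tp S) (σc(S)E₁₁) (gc S·h)`; (h2) `v ∈ Tp S ↔ v ∈ T_rec ∨ 1 < |ι_v τ(σc S)|_v` (`T_rec` independent of `S`); (h3) `Pm S h = T S h ∖ T₀`;
(h4) for rank-one `S`: `v ∈ D S h ↔ |ι_v τ(σc S)|_v ≠ 1 ∧ v ∉ T S h`; (h5) `mτ S v = (−log|ι_v τ(σc S)|_v).toNat`; (j) `v ∉ T S h → v ∉ T₀ ∧ v ∉ T_rec ∧ |ι_v τ(σc S)|_v ≤ 1`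
(`τ(σ) := t₁·Tr_{L∕L⁺}(σδ)`).  Proof: ★ (C-b) ∘ ★ (C-a) ∘ ★ FILE W at `S' := σc(S)E₁₁`, `h' := gc S·h`, `T₁ := T_rec ∪ Pol(τ(σc S))`.
[cite: KudlaRallis1994, §2 (2.10)–(2.12)] [cite: Tan1999, §3; §4 Prop. 4.8] [cite: Shimura1997, §18.4] [cite: MoeglinWaldspurger1995, II.1.7] [cite: CasselsFrohlichANT1967, Ch. XV Thm. 3.3.1] -/
theorem htail_hsplit_witnesses_of_record (hdV0 : ∀ i, dV i ≠ 0) (hdW0 : ∀ i, dW i ≠ 0)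
    -- the Levi chart and the row section BY VALUE (★ (C-b)'s binders)
    (Λ : GL (Fin 2) (AdeleRing (𝓞 L) L) →* HA L e dV hdV dW hdW)
    (hΛ : ∀ g : GL (Fin 2) (AdeleRing (𝓞 L) L), blk L e dV hdV dW hdW (Λ g) =
      cayR (AdeleRing (𝓞 L) L) (Fin 2) * Matrix.fromBlocks (g : Matrix (Fin 2) (Fin 2) (AdeleRing (𝓞 L) L)) 0 0
        (((gramR L e dV hdV dW hdW).map ((algebraMap L (AdeleRing (𝓞 L) L)).comp (algebraMap (Fp L) L)))⁻¹ *
          (((g⁻¹ : GL (Fin 2) (AdeleRing (𝓞 L) L)) : Matrix (Fin 2) (Fin 2) (AdeleRing (𝓞 L) L)).map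
            (conjAdele (Fp L) L (IsCMField.complexConj L)))ᵀ *
          (gramR L e dV hdV dW hdW).map ((algebraMap L (AdeleRing (𝓞 L) L)).comp (algebraMap (Fp L) L))) *
        cayRinv (AdeleRing (𝓞 L) L) (Fin 2))
    (γ : Projectivization L (Fin 2 → L) → GL (Fin 2) L)
    (hγ : ∀ p, Projectivization.mk L ((γ p : Matrix (Fin 2) (Fin 2) L) 1) (row_ne_zero (γ p) 1) = p)
    {lam : IdeleClassGroup L →ₜ* Circle} (hlam : IsConjugateSymplectic L lam)
    {f : ℂ → HA L e dV hdV dW hdW → ℂ} (hsec : ∀ s : ℂ, IsSiegelDeltaSection L e dV hdV dW hdW (toHeckeCharacter L lam⁻¹) s (f s)) (hcont : ∀ s, Continuous (f s))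
    (νN : Measure ↥(unipDelta L e dV hdV dW hdW)) [νN.IsHaarMeasure] (c₀ : ℝ)
    -- the Whittaker–Euler data BY VALUE (as ★ (W1)): bad set, local and archimedean carriers, the factorisation of `νN` at every `T`
    (T₀ : Finset (HeightOneSpectrum (𝓞 (Fp L))))
    (νv : ∀ v : HeightOneSpectrum (𝓞 (Fp L)), Measure ↥(unipDeltaLoc L e dV hdV dW hdW v)) [∀ v, (νv v).IsHaarMeasure] [∀ v, SigmaFinite (νv v)]
    (hνK : ∀ v, νv v (((inH (fun v => UnitaryGroup.localInt L (IsCMField.complexConj L) (2 + 2) (hermD L e dV hdV dW hdW) v)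
      (fun v => unipDeltaLoc L e dV hdV dW hdW v) v) : Subgroup ↥(unipDeltaLoc L e dV hdV dW hdW v)) : Set ↥(unipDeltaLoc L e dV hdV dW hdW v)) = 1)
    (νinf : Finset (HeightOneSpectrum (𝓞 (Fp L))) → Measure ↥(unipDeltaArch L e dV hdV dW hdW)) (hσ : ∀ T, SigmaFinite (νinf T))
    (hmap : ∀ T : Finset (HeightOneSpectrum (𝓞 (Fp L))), Measure.map (unipDeltaSplitAt L e dV hdV dW hdW T) νN =
      (νinf T).prod ((Measure.pi fun v : T => νv v.1).prod
        (rpMeasure (fun v : {v : HeightOneSpectrum (𝓞 (Fp L)) // v ∉ T} => ((inH (fun v => UnitaryGroup.localInt L (IsCMField.complexConj L) (2 + 2) (hermD L e dV hdV dW hdW) v)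
          (fun v => unipDeltaLoc L e dV hdV dW hdW v) v.1 : Subgroup ↥(unipDeltaLoc L e dV hdV dW hdW v.1)) : Set ↥(unipDeltaLoc L e dV hdV dW hdW v.1))) (fun v => νv v.1) ∅)))
    (hχ : ∀ v, v ∉ T₀ → ∀ w' : UnitaryGroup.PlacesOver L v, (toHeckeCharacter L lam⁻¹).IsUnramifiedAt w'.1)
    (hfac : ∀ T : Finset (HeightOneSpectrum (𝓞 (Fp L))), T₀ ⊆ T →
      IsFactorizableOff L e dV hdV dW hdW T (toHeckeCharacter L lam⁻¹) f (fun s x => f s (placesEmbed L (hermD L e dV hdV dW hdW) T x)))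
    -- the Σ⊗ STRUCTURE of the slices, place-indexed (★ (KW-fac) `exists_kindW_factorization` (3)'s shape), ONE `m` for all `T ⊇ T₀`
    {m : ℕ} (Finf : Fin m → ℂ → UnitaryGroup.arch (Fp L) L (IsCMField.complexConj L) (2 + 2) (hermD L e dV hdV dW hdW) → ℂ)
    (Fv : Fin m → ∀ v : HeightOneSpectrum (𝓞 (Fp L)), ℂ → UnitaryGroup.localPi L (IsCMField.complexConj L) (2 + 2) (hermD L e dV hdV dW hdW) v → ℂ)
    (hslice : ∀ T : Finset (HeightOneSpectrum (𝓞 (Fp L))), T₀ ⊆ T →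
      ∀ (s : ℂ) (a : UnitaryGroup.arch (Fp L) L (IsCMField.complexConj L) (2 + 2) (hermD L e dV hdV dW hdW))
        (y : Π v : ↥T, UnitaryGroup.localPi L (IsCMField.complexConj L) (2 + 2) (hermD L e dV hdV dW hdW) v.1),
        f s (placesEmbed L (hermD L e dV hdV dW hdW) T (a, y)) = ∑ j, Finf j s a * ∏ v : ↥T, Fv j v.1 s (y v))
    -- per-FACTOR integrability on `{1 < re s}` at every index and every point: the archimedean letter (KIND-W `hintArch`) and the local letter (★ (iii-fin-int))
    (hintArch : ∀ (S' : Matrix (Fin 2) (Fin 2) L) (h' : HA L e dV hdV dW hdW) (T : Finset (HeightOneSpectrum (𝓞 (Fp L)))) (s : ℂ) (j : Fin m), 1 < s.re →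
      Integrable (fun a : ↥(unipDeltaArch L e dV hdV dW hdW) =>
        conj (unipDeltaChar L e dV hdV dW hdW S'
            (UnitaryGroup.archToAdelic (Fp L) L (IsCMField.complexConj L) (2 + 2) (hermD L e dV hdV dW hdW)
              (a : UnitaryGroup.arch (Fp L) L (IsCMField.complexConj L) (2 + 2) (hermD L e dV hdV dW hdW))) : ℂ) *
          Finf j s (UnitaryGroup.archPart (Fp L) L (IsCMField.complexConj L) (2 + 2) (hermD L e dV hdV dW hdW) (weylDelta L e dV hdV dW hdW) *
              (a : UnitaryGroup.arch (Fp L) L (IsCMField.complexConj L) (2 + 2) (hermD L e dV hdV dW hdW)) *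
              UnitaryGroup.archPart (Fp L) L (IsCMField.complexConj L) (2 + 2) (hermD L e dV hdV dW hdW) h')) (νinf T))
    (hintLoc : ∀ (S' : Matrix (Fin 2) (Fin 2) L) (h' : HA L e dV hdV dW hdW) (v : HeightOneSpectrum (𝓞 (Fp L))) (s : ℂ) (j : Fin m), 1 < s.re →
      Integrable (fun y : ↥(unipDeltaLoc L e dV hdV dW hdW v) =>
        conj (unipDeltaChar L e dV hdV dW hdW S'
            (locToAdelic L e dV hdV dW hdW v (y : UnitaryGroup.localPi L (IsCMField.complexConj L) (2 + 2) (hermD L e dV hdV dW hdW) v)) : ℂ) *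
          Fv j v s (UnitaryGroup.evalPlace (Fp L) L (IsCMField.complexConj L) (2 + 2) (hermD L e dV hdV dW hdW) v
                (UnitaryGroup.finPart (Fp L) L (IsCMField.complexConj L) (2 + 2) (hermD L e dV hdV dW hdW) (weylDelta L e dV hdV dW hdW)) *
              (y : UnitaryGroup.localPi L (IsCMField.complexConj L) (2 + 2) (hermD L e dV hdV dW hdW) v) *
              UnitaryGroup.evalPlace (Fp L) L (IsCMField.complexConj L) (2 + 2) (hermD L e dV hdV dW hdW) v
                (UnitaryGroup.finPart (Fp L) L (IsCMField.complexConj L) (2 + 2) (hermD L e dV hdV dW hdW) h'))) (νv v)) :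
    ∃ (σc : skewMatrices ((IsCMField.complexConj L : L ≃ₐ[Fp L] L) : L →+* L) ((gramR L e dV hdV dW hdW).map (algebraMap (Fp L) L)) → L)
      (gc : skewMatrices ((IsCMField.complexConj L : L ≃ₐ[Fp L] L) : L →+* L) ((gramR L e dV hdV dW hdW).map (algebraMap (Fp L) L)) → HA L e dV hdV dW hdW)
      (T D Pm : skewMatrices ((IsCMField.complexConj L : L ≃ₐ[Fp L] L) : L →+* L) ((gramR L e dV hdV dW hdW).map (algebraMap (Fp L) L)) → HA L e dV hdV dW hdW →
        Finset (HeightOneSpectrum (𝓞 (Fp L))))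
      (mτ : skewMatrices ((IsCMField.complexConj L : L ≃ₐ[Fp L] L) : L →+* L) ((gramR L e dV hdV dW hdW).map (algebraMap (Fp L) L)) → HeightOneSpectrum (𝓞 (Fp L)) → ℕ)
      (A : skewMatrices ((IsCMField.complexConj L : L ≃ₐ[Fp L] L) : L →+* L) ((gramR L e dV hdV dW hdW).map (algebraMap (Fp L) L)) → Fin m → ℂ → HA L e dV hdV dW hdW → ℂ)
      (W : skewMatrices ((IsCMField.complexConj L : L ≃ₐ[Fp L] L) : L →+* L) ((gramR L e dV hdV dW hdW).map (algebraMap (Fp L) L)) → Fin m →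
        HeightOneSpectrum (𝓞 (Fp L)) → ℂ → HA L e dV hdV dW hdW → ℂ),
      -- (a) the corner transport (★ (K1a-1), letters discharged in ★ (C-b))
      (∀ S : skewMatrices ((IsCMField.complexConj L : L ≃ₐ[Fp L] L) : L →+* L) ((gramR L e dV hdV dW hdW).map (algebraMap (Fp L) L)),
        (S : Matrix (Fin 2) (Fin 2) L) ≠ 0 → (S : Matrix (Fin 2) (Fin 2) L).det = 0 → ∀ (s : ℂ) (h : HA L e dV hdV dW hdW),
          whittakerDelta L e dV hdV dW hdW νN (S : Matrix (Fin 2) (Fin 2) L) (f s) h =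
            whittakerDelta L e dV hdV dW hdW νN (Matrix.single 1 1 (σc S)) (f s) (gc S * h)) ∧
      -- (b) WITNESS EQUATIONS: the raw archimedean ∕ local twisted integrals of the `j`-th pure tensor at the corner index and the translate (the localFace junction of record)
      (∀ (S : skewMatrices ((IsCMField.complexConj L : L ≃ₐ[Fp L] L) : L →+* L) ((gramR L e dV hdV dW hdW).map (algebraMap (Fp L) L))) (j : Fin m) (s : ℂ) (h : HA L e dV hdV dW hdW),
        A S j s h = ∫ a, conj (unipDeltaChar L e dV hdV dW hdW (Matrix.single 1 1 (σc S))
            (UnitaryGroup.archToAdelic (Fp L) L (IsCMField.complexConj L) (2 + 2) (hermD L e dV hdV dW hdW)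
              (a : UnitaryGroup.arch (Fp L) L (IsCMField.complexConj L) (2 + 2) (hermD L e dV hdV dW hdW))) : ℂ) *
          Finf j s (UnitaryGroup.archPart (Fp L) L (IsCMField.complexConj L) (2 + 2) (hermD L e dV hdV dW hdW) (weylDelta L e dV hdV dW hdW) *
              (a : UnitaryGroup.arch (Fp L) L (IsCMField.complexConj L) (2 + 2) (hermD L e dV hdV dW hdW)) *
              UnitaryGroup.archPart (Fp L) L (IsCMField.complexConj L) (2 + 2) (hermD L e dV hdV dW hdW) (gc S * h)) ∂(νinf (T S h))) ∧
      (∀ (S : skewMatrices ((IsCMField.complexConj L : L ≃ₐ[Fp L] L) : L →+* L) ((gramR L e dV hdV dW hdW).map (algebraMap (Fp L) L))) (j : Fin m)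
        (v : HeightOneSpectrum (𝓞 (Fp L))) (s : ℂ) (h : HA L e dV hdV dW hdW),
        W S j v s h = ∫ y, conj (unipDeltaChar L e dV hdV dW hdW (Matrix.single 1 1 (σc S))
            (locToAdelic L e dV hdV dW hdW v (y : UnitaryGroup.localPi L (IsCMField.complexConj L) (2 + 2) (hermD L e dV hdV dW hdW) v)) : ℂ) *
          Fv j v s (UnitaryGroup.evalPlace (Fp L) L (IsCMField.complexConj L) (2 + 2) (hermD L e dV hdV dW hdW) v
                (UnitaryGroup.finPart (Fp L) L (IsCMField.complexConj L) (2 + 2) (hermD L e dV hdV dW hdW) (weylDelta L e dV hdV dW hdW)) *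
              (y : UnitaryGroup.localPi L (IsCMField.complexConj L) (2 + 2) (hermD L e dV hdV dW hdW) v) *
              UnitaryGroup.evalPlace (Fp L) L (IsCMField.complexConj L) (2 + 2) (hermD L e dV hdV dW hdW) v
                (UnitaryGroup.finPart (Fp L) L (IsCMField.complexConj L) (2 + 2) (hermD L e dV hdV dW hdW) (gc S * h))) ∂(νv v)) ∧
      -- (c) place-set letters: `T₀ ⊆ T S h`; `Pm S h ∩ T₀ = ∅` (★ p863404's `hPT` at `T'' := ↑T₀`); `↑T₀ ∪ ↑(Pm S h) = ↑(T S h)`; `D S h ∩ T S h = ∅`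
      (∀ S (h : HA L e dV hdV dW hdW), T₀ ⊆ T S h) ∧
      (∀ S (h : HA L e dV hdV dW hdW), ∀ v ∈ Pm S h, v ∉ (T₀ : Set (HeightOneSpectrum (𝓞 (Fp L))))) ∧
      (∀ S (h : HA L e dV hdV dW hdW), (T₀ : Set (HeightOneSpectrum (𝓞 (Fp L)))) ∪ (Pm S h : Set (HeightOneSpectrum (𝓞 (Fp L)))) = (T S h : Set (HeightOneSpectrum (𝓞 (Fp L))))) ∧
      (∀ S (h : HA L e dV hdV dW hdW), ∀ v ∈ D S h, v ∉ T S h) ∧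
      -- (d) `hq` (`q := residueCard`) and `hP` (★ p863404's binders)
      (∀ S (h : HA L e dV hdV dW hdW), ∀ v ∈ T S h, v.residueCard ≠ 0) ∧
      (∀ S : skewMatrices ((IsCMField.complexConj L : L ≃ₐ[Fp L] L) : L →+* L) ((gramR L e dV hdV dW hdW).map (algebraMap (Fp L) L)),
        (S : Matrix (Fin 2) (Fin 2) L) ≠ 0 → (S : Matrix (Fin 2) (Fin 2) L).det = 0 → ∀ (h : HA L e dV hdV dW hdW), ∀ v ∈ D S h,
          DifferentiableOn ℂ (fun s : ℂ => ∑ k ∈ Finset.range (mτ S v + 1), ((quadraticHeckeCharCM L).valueAtUniformizer v * (v.residueCard : ℂ) ^ (1 - 2 * s)) ^ k)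
            {s : ℂ | 0 < s.re}) ∧
      -- (e) `htail ∘ hsplit`: the singular tail of record
      (∀ S : skewMatrices ((IsCMField.complexConj L : L ≃ₐ[Fp L] L) : L →+* L) ((gramR L e dV hdV dW hdW).map (algebraMap (Fp L) L)),
        (S : Matrix (Fin 2) (Fin 2) L) ≠ 0 → (S : Matrix (Fin 2) (Fin 2) L).det = 0 → ∀ (s : ℂ) (h : HA L e dV hdV dW hdW), 1 < s.re →
          (c₀ : ℝ) • whittakerDelta L e dV hdV dW hdW νN (S : Matrix (Fin 2) (Fin 2) L) (f s) h =
            (c₀ : ℂ) * (∑ j, A S j s h * ∏ v ∈ T S h, W S j v s h) *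
              (partialStandardL ((T₀ : Set (HeightOneSpectrum (𝓞 (Fp L)))) ∪ (Pm S h : Set (HeightOneSpectrum (𝓞 (Fp L))))) (fun _ => {1}) (2 * s) /
                (partialStandardL ((T₀ : Set (HeightOneSpectrum (𝓞 (Fp L)))) ∪ (Pm S h : Set (HeightOneSpectrum (𝓞 (Fp L))))) (fun _ => {1}) (2 * s + 1) *
                  partialStandardL ((T₀ : Set (HeightOneSpectrum (𝓞 (Fp L)))) ∪ (Pm S h : Set (HeightOneSpectrum (𝓞 (Fp L)))))
                    (fun v => {(quadraticHeckeCharCM L).valueAtUniformizer v}) (2 * s + 2))) *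
              ∏ v ∈ D S h, ∑ k ∈ Finset.range (mτ S v + 1), ((quadraticHeckeCharCM L).valueAtUniformizer v * (v.residueCard : ℂ) ^ (1 - 2 * s)) ^ k) ∧
      -- THE DEFINING LETTERS OF THE WITNESSES: the rank-one presentation `(u, w)`, the record set `T_rec` (INDEPENDENT of `S`) and the exceptional-set map `Tp`
      ∃ (u w : skewMatrices ((IsCMField.complexConj L : L ≃ₐ[Fp L] L) : L →+* L) ((gramR L e dV hdV dW hdW).map (algebraMap (Fp L) L)) → Fin 2 → L)
        (hw : ∀ S, w S ≠ 0) (Trec : Finset (HeightOneSpectrum (𝓞 (Fp L))))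
        (Tp : skewMatrices ((IsCMField.complexConj L : L ≃ₐ[Fp L] L) : L →+* L) ((gramR L e dV hdV dW hdW).map (algebraMap (Fp L) L)) → Finset (HeightOneSpectrum (𝓞 (Fp L)))),
        -- (f) the translate IS `Λ(map γ[w S])`
        (∀ S, gc S = Λ (Matrix.GeneralLinearGroup.map (algebraMap L (AdeleRing (𝓞 L) L)) (γ (Projectivization.mk L (w S) (hw S))))) ∧
        -- (g) the rank-one presentation of record (★ (C-b)): `↑S = u ⊗ w`, the diagonal identities, `τ(σc S) ≠ 0`
        (∀ S : skewMatrices ((IsCMField.complexConj L : L ≃ₐ[Fp L] L) : L →+* L) ((gramR L e dV hdV dW hdW).map (algebraMap (Fp L) L)),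
          (S : Matrix (Fin 2) (Fin 2) L) ≠ 0 → (S : Matrix (Fin 2) (Fin 2) L).det = 0 →
            (S : Matrix (Fin 2) (Fin 2) L) = Matrix.vecMulVec (u S) (w S) ∧
            (∀ k : Fin 2, ((gramR L e dV hdV dW hdW).map (algebraMap (Fp L) L)) k k * (S : Matrix (Fin 2) (Fin 2) L) k k =
              IsCMField.complexConj L (((γ (Projectivization.mk L (w S) (hw S)) : GL (Fin 2) L) : Matrix (Fin 2) (Fin 2) L) 1 k) *
                ((gramR L e dV hdV dW hdW).map (algebraMap (Fp L) L)) 1 1 * σc S * ((γ (Projectivization.mk L (w S) (hw S)) : GL (Fin 2) L) : Matrix (Fin 2) (Fin 2) L) 1 k) ∧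
            gramR L e dV hdV dW hdW 1 1 * Algebra.trace (Fp L) L (σc S * imagUnit L) ≠ 0) ∧
        -- (h1) the exceptional set IS the KIND-W set at `T₀ ∪ Tp S`, the corner index and the translate
        (∀ S (h : HA L e dV hdV dW hdW), T S h = kindWFinset L e dV hdV dW hdW (T₀ ∪ Tp S) (Matrix.single 1 1 (σc S)) (gc S * h)) ∧
        -- (h2) `Tp S = T_rec ∪ Pol(τ(σc S))`
        (∀ S (v : HeightOneSpectrum (𝓞 (Fp L))), v ∈ Tp S ↔
          v ∈ Trec ∨ 1 < Valued.v (algebraMap (Fp L) (v.adicCompletion (Fp L)) (gramR L e dV hdV dW hdW 1 1 * Algebra.trace (Fp L) L (σc S * imagUnit L)))) ∧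
        -- (h3) `Pm S h = T S h ∖ T₀`
        (∀ S (h : HA L e dV hdV dW hdW), Pm S h = T S h \ T₀) ∧
        -- (h4) `D S h = {v : |ι_v τ(σc S)|_v ≠ 1} ∖ T S h` for rank-one `S`
        (∀ S : skewMatrices ((IsCMField.complexConj L : L ≃ₐ[Fp L] L) : L →+* L) ((gramR L e dV hdV dW hdW).map (algebraMap (Fp L) L)),
          (S : Matrix (Fin 2) (Fin 2) L) ≠ 0 → (S : Matrix (Fin 2) (Fin 2) L).det = 0 → ∀ (h : HA L e dV hdV dW hdW) (v : HeightOneSpectrum (𝓞 (Fp L))),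
            v ∈ D S h ↔ Valued.v (algebraMap (Fp L) (v.adicCompletion (Fp L)) (gramR L e dV hdV dW hdW 1 1 * Algebra.trace (Fp L) L (σc S * imagUnit L))) ≠ 1 ∧ v ∉ T S h) ∧
        -- (h5) `mτ S v = ord_v τ(σc S)` (as a natural number: `(−log|ι_v τ|_v).toNat`)
        (∀ S (v : HeightOneSpectrum (𝓞 (Fp L))),
          mτ S v = (-WithZero.log (Valued.v (algebraMap (Fp L) (v.adicCompletion (Fp L)) (gramR L e dV hdV dW hdW 1 1 * Algebra.trace (Fp L) L (σc S * imagUnit L))))).toNat) ∧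
        -- (j) off `T S h`: not a datum place, not a record place, `τ(σc S)` is `v`-integral
        (∀ S (h : HA L e dV hdV dW hdW) (v : HeightOneSpectrum (𝓞 (Fp L))), v ∉ T S h →
          v ∉ T₀ ∧ v ∉ Trec ∧ Valued.v (algebraMap (Fp L) (v.adicCompletion (Fp L)) (gramR L e dV hdV dW hdW 1 1 * Algebra.trace (Fp L) L (σc S * imagUnit L))) ≤ 1) := by
  have hχu : (toHeckeCharacter L lam⁻¹).IsUnitary := isUnitary_toHeckeCharacter L lam⁻¹
  -- ★ (C-b): the corner value with its presentation, for the given `Λ`, `γ`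
  obtain ⟨σc, u, w, hw, hk⟩ := exists_cornerPresentation_of_record L e dV hdV dW hdW hdV0 hdW0 Λ hΛ γ hγ
  -- ★ (C-a): ONE record set `T_rec` carrying the value letter for every `σ` with `τ(σ) ≠ 0` off the poles of `τ(σ)`
  obtain ⟨Trec, hTrec⟩ := exists_recordFinset_forall_integral_conjChar_lambdaLoc_weylDelta_eq L e dV hdV dW hdW hdV0 hdW0 hlam
  -- the pole set of `τ(σc S)` (finite for every `S`)
  have hpol : ∀ S : skewMatrices ((IsCMField.complexConj L : L ≃ₐ[Fp L] L) : L →+* L) ((gramR L e dV hdV dW hdW).map (algebraMap (Fp L) L)),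
      ∃ P : Finset (HeightOneSpectrum (𝓞 (Fp L))), ∀ v, v ∈ P ↔
        1 < Valued.v (algebraMap (Fp L) (v.adicCompletion (Fp L)) (gramR L e dV hdV dW hdW 1 1 * Algebra.trace (Fp L) L (σc S * imagUnit L))) := fun S =>
    ⟨(setOf_one_lt_valued_finite L _).toFinset, fun v => Set.Finite.mem_toFinset _⟩
  choose Pol hPol using hpol
  -- the shell set `{v : |ι_v τ|_v ≠ 1}` (finite on rank one, where `τ ≠ 0`)
  have hshell : ∀ S : skewMatrices ((IsCMField.complexConj L : L ≃ₐ[Fp L] L) : L →+* L) ((gramR L e dV hdV dW hdW).map (algebraMap (Fp L) L)),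
      ∃ Dτ : Finset (HeightOneSpectrum (𝓞 (Fp L))), (S : Matrix (Fin 2) (Fin 2) L) ≠ 0 → (S : Matrix (Fin 2) (Fin 2) L).det = 0 → ∀ v, v ∈ Dτ ↔
        Valued.v (algebraMap (Fp L) (v.adicCompletion (Fp L)) (gramR L e dV hdV dW hdW 1 1 * Algebra.trace (Fp L) L (σc S * imagUnit L))) ≠ 1 := by
    intro S
    by_cases hr : (S : Matrix (Fin 2) (Fin 2) L) ≠ 0 ∧ (S : Matrix (Fin 2) (Fin 2) L).det = 0
    · exact ⟨(Filter.eventually_cofinite.1 (UnitaryGroup.eventually_valued_algebraMap_eq_one (Fp L) (hk S hr.1 hr.2).2.2.1)).toFinset,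
        fun _ _ v => Set.Finite.mem_toFinset _⟩
    · exact ⟨∅, fun h0 hd => absurd ⟨h0, hd⟩ hr⟩
  choose Dτ hDτ using hshell
  -- THE WITNESSES (explicit in `σc w hw Trec Pol Dτ Λ γ`)
  refine ⟨σc, fun S => Λ (Matrix.GeneralLinearGroup.map (algebraMap L (AdeleRing (𝓞 L) L)) (γ (Projectivization.mk L (w S) (hw S)))),
    fun S h => kindWFinset L e dV hdV dW hdW (T₀ ∪ (Trec ∪ Pol S)) (Matrix.single 1 1 (σc S))
      (Λ (Matrix.GeneralLinearGroup.map (algebraMap L (AdeleRing (𝓞 L) L)) (γ (Projectivization.mk L (w S) (hw S)))) * h),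
    fun S h => (Dτ S).filter (fun v => v ∉ kindWFinset L e dV hdV dW hdW (T₀ ∪ (Trec ∪ Pol S)) (Matrix.single 1 1 (σc S))
      (Λ (Matrix.GeneralLinearGroup.map (algebraMap L (AdeleRing (𝓞 L) L)) (γ (Projectivization.mk L (w S) (hw S)))) * h)),
    fun S h => kindWFinset L e dV hdV dW hdW (T₀ ∪ (Trec ∪ Pol S)) (Matrix.single 1 1 (σc S))
      (Λ (Matrix.GeneralLinearGroup.map (algebraMap L (AdeleRing (𝓞 L) L)) (γ (Projectivization.mk L (w S) (hw S)))) * h) \ T₀,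
    fun S v => (-WithZero.log (Valued.v (algebraMap (Fp L) (v.adicCompletion (Fp L)) (gramR L e dV hdV dW hdW 1 1 * Algebra.trace (Fp L) L (σc S * imagUnit L))))).toNat,
    fun S j s h => ∫ a, conj (unipDeltaChar L e dV hdV dW hdW (Matrix.single 1 1 (σc S))
            (UnitaryGroup.archToAdelic (Fp L) L (IsCMField.complexConj L) (2 + 2) (hermD L e dV hdV dW hdW)
              (a : UnitaryGroup.arch (Fp L) L (IsCMField.complexConj L) (2 + 2) (hermD L e dV hdV dW hdW))) : ℂ) *
          Finf j s (UnitaryGroup.archPart (Fp L) L (IsCMField.complexConj L) (2 + 2) (hermD L e dV hdV dW hdW) (weylDelta L e dV hdV dW hdW) *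
              (a : UnitaryGroup.arch (Fp L) L (IsCMField.complexConj L) (2 + 2) (hermD L e dV hdV dW hdW)) *
              UnitaryGroup.archPart (Fp L) L (IsCMField.complexConj L) (2 + 2) (hermD L e dV hdV dW hdW)
                (Λ (Matrix.GeneralLinearGroup.map (algebraMap L (AdeleRing (𝓞 L) L)) (γ (Projectivization.mk L (w S) (hw S)))) * h))
          ∂(νinf (kindWFinset L e dV hdV dW hdW (T₀ ∪ (Trec ∪ Pol S)) (Matrix.single 1 1 (σc S))
            (Λ (Matrix.GeneralLinearGroup.map (algebraMap L (AdeleRing (𝓞 L) L)) (γ (Projectivization.mk L (w S) (hw S)))) * h))),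
    fun S j v s h => ∫ y, conj (unipDeltaChar L e dV hdV dW hdW (Matrix.single 1 1 (σc S))
            (locToAdelic L e dV hdV dW hdW v (y : UnitaryGroup.localPi L (IsCMField.complexConj L) (2 + 2) (hermD L e dV hdV dW hdW) v)) : ℂ) *
          Fv j v s (UnitaryGroup.evalPlace (Fp L) L (IsCMField.complexConj L) (2 + 2) (hermD L e dV hdV dW hdW) v
                (UnitaryGroup.finPart (Fp L) L (IsCMField.complexConj L) (2 + 2) (hermD L e dV hdV dW hdW) (weylDelta L e dV hdV dW hdW)) *
              (y : UnitaryGroup.localPi L (IsCMField.complexConj L) (2 + 2) (hermD L e dV hdV dW hdW) v) *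
              UnitaryGroup.evalPlace (Fp L) L (IsCMField.complexConj L) (2 + 2) (hermD L e dV hdV dW hdW) v
                (UnitaryGroup.finPart (Fp L) L (IsCMField.complexConj L) (2 + 2) (hermD L e dV hdV dW hdW)
                  (Λ (Matrix.GeneralLinearGroup.map (algebraMap L (AdeleRing (𝓞 L) L)) (γ (Projectivization.mk L (w S) (hw S)))) * h))) ∂(νv v),
    fun S hS0 hdet s h => (hk S hS0 hdet).2.2.2 νN (toHeckeCharacter L lam⁻¹) s (f s) (hsec s) h,
    fun _ _ _ _ => rfl, fun _ _ _ _ _ => rfl,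
    fun S h => Finset.subset_union_left.trans (subset_kindWFinset L e dV hdV dW hdW _ _ _),
    fun S h v hv => fun hv0 => (Finset.mem_sdiff.1 hv).2 (Finset.mem_coe.1 hv0),
    fun S h => ?_, fun S h v hv => (Finset.mem_filter.1 hv).2,
    fun S h v _ => by have := v.one_lt_residueCard; omega,
    fun S _ _ h v _ => (differentiable_twistedPoly _ (by have := v.one_lt_residueCard; omega) _).differentiableOn,
    fun S hS0 hdet s h hs => ?_,
    u, w, hw, Trec, fun S => Trec ∪ Pol S,
    fun _ => rfl,
    fun S hS0 hdet => ⟨(hk S hS0 hdet).1, (hk S hS0 hdet).2.1, (hk S hS0 hdet).2.2.1⟩,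
    fun _ _ => rfl,
    fun S v => by rw [Finset.mem_union, hPol S v],
    fun _ _ => rfl,
    fun S hS0 hdet h v => by rw [Finset.mem_filter, hDτ S hS0 hdet v],
    fun _ _ => rfl,
    fun S h v hv => ?_⟩
  · -- `↑T₀ ∪ ↑(T S h ∖ T₀) = ↑(T S h)` since `T₀ ⊆ T S h`
    rw [Finset.coe_sdiff, Set.union_sdiff_self, Set.union_eq_right]
    exact Finset.coe_subset.2 (Finset.subset_union_left.trans (subset_kindWFinset L e dV hdV dW hdW _ _ _))
  · -- (e) THE TAIL: ★ (C-b) transport, then ★ FILE W at the corner index and the translate with `T₁ := T_rec ∪ Pol(τ)`, value letter ★ (C-a)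
    obtain ⟨-, -, hτ0, htrans⟩ := hk S hS0 hdet
    have hsub : T₀ ⊆ kindWFinset L e dV hdV dW hdW (T₀ ∪ (Trec ∪ Pol S)) (Matrix.single 1 1 (σc S))
        (Λ (Matrix.GeneralLinearGroup.map (algebraMap L (AdeleRing (𝓞 L) L)) (γ (Projectivization.mk L (w S) (hw S)))) * h) :=
      Finset.subset_union_left.trans (subset_kindWFinset L e dV hdV dW hdW _ _ _)
    have hU : (T₀ : Set (HeightOneSpectrum (𝓞 (Fp L)))) ∪
        ((kindWFinset L e dV hdV dW hdW (T₀ ∪ (Trec ∪ Pol S)) (Matrix.single 1 1 (σc S))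
            (Λ (Matrix.GeneralLinearGroup.map (algebraMap L (AdeleRing (𝓞 L) L)) (γ (Projectivization.mk L (w S) (hw S)))) * h) \ T₀ :
              Finset (HeightOneSpectrum (𝓞 (Fp L)))) : Set (HeightOneSpectrum (𝓞 (Fp L)))) =
        (kindWFinset L e dV hdV dW hdW (T₀ ∪ (Trec ∪ Pol S)) (Matrix.single 1 1 (σc S))
            (Λ (Matrix.GeneralLinearGroup.map (algebraMap L (AdeleRing (𝓞 L) L)) (γ (Projectivization.mk L (w S) (hw S)))) * h) :
          Set (HeightOneSpectrum (𝓞 (Fp L)))) := by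
      rw [Finset.coe_sdiff, Set.union_sdiff_self, Set.union_eq_right.2 (Finset.coe_subset.2 hsub)]
    have hm : ∀ v, v ∉ Dτ S →
        (-WithZero.log (Valued.v (algebraMap (Fp L) (v.adicCompletion (Fp L)) (gramR L e dV hdV dW hdW 1 1 * Algebra.trace (Fp L) L (σc S * imagUnit L))))).toNat = 0 := by
      intro v hv
      rw [not_not.1 (fun h1 => hv ((hDτ S hS0 hdet v).2 h1)), WithZero.log_one, neg_zero, Int.toNat_zero]
    beta_reduce
    rw [hU, Complex.real_smul, htrans νN (toHeckeCharacter L lam⁻¹) s (f s) (hsec s) h, ← Complex.real_smul]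
    exact htail_hsplit_of_cornerLetters L e dV hdV dW hdW hdV0 hdW0 hχu hsec hcont νN c₀ T₀ νv hνK νinf hσ hmap hχ hfac Finf Fv hslice hintArch hintLoc
      (Matrix.single 1 1 (σc S)) _ (Trec ∪ Pol S) _ (Dτ S) hm
      (fun v hv s' hs' => by
        rw [Finset.mem_union, not_or] at hv
        exact hTrec (σc S) hτ0 v hv.1 (not_lt.1 (fun h1 => hv.2 ((hPol S v).2 h1))) (νv v) (hνK v) s' hs') hs
  · -- (j) off `T S h`: `v ∉ T₀ ∪ (T_rec ∪ Pol(τ))`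
    have hv' : v ∉ T₀ ∪ (Trec ∪ Pol S) := fun h' => hv (subset_kindWFinset L e dV hdV dW hdW _ _ _ h')
    rw [Finset.mem_union, Finset.mem_union, not_or, not_or] at hv'
    exact ⟨hv'.1, hv'.2.1, not_lt.1 (fun h1 => hv'.2.2 ((hPol S v).2 h1))⟩

end Head

end Summit.HodgeConjecture.HodgeConjecture.Cruxes.HLiu418.K2LiuKindOneSingularTailWitnesses

end
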